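import Literature.Geometry.Riemannian.CylinderChartScalarPrinted
import Literature.Geometry.Riemannian.NormalFormSliceCalculus
import Literature.Geometry.Riemannian.NormalFormSpaceDerivatives
import Literature.Geometry.Lorentzian.CoordCylinderNormalFormPointwise
import HarnessLib

/-!
# The deformed cylinder has positive scalar curvature, II: the region near the boundary

Topic `Literature/Geometry/Riemannian`. A brick (K5d-B of the notes) of the proof of the named
fact `Literature.Geometry.Riemannian.BarHanke2023_thm27_umbilicNormalForm` (Bär–Hanke, §3,
Thm. 27). For the deformed generalized cylinder `G'` (`CylinderNormalFormMetric.lean`), read in a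
chart through `CylinderNormalFormChart.normalFormComponents_eq`, at a time `t ∈ [0, 1]` where
the logarithmic cutoff `a` equals `1` to second order (the region `t ≤ √δ` of Bär–Hanke's proof of
Prop. 26, where `G' = γ_t + dt²`, `γ_t = g₀ + (t − χ(t))ġ₀ − (Ct² + 2μχ(t)) g₀`), the pointwise
estimate `MetricCoord.stepB_pointwise` applies and gives

  `scal_{G'}(z, t) ≥ 2C(n − ½) − 2042 n² b'⁵ − 4 n b'³ (L + c₀)`

(`regionB_scalarCurvature_lower_bound`). Here `b` bounds the chart data of `G` at `t = 0` and of
`μ̃ = μ ∘ ψ⁻¹`, `b'` is the derived constant of step B, `d ≥ Ct²b + |t − χ(t)| b + 8|χ(t)| b²` the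
`C²`-distance of the slices, and the mean-curvature hypothesis `H_g(z) + n μ(z) ≤ 0` (tree
convention) gives `tr_{g₀}(−μ g₀ − ½ġ₀) ≥ 0`, i.e. `tr(h − k) ≥ 0` with `h = −½ġ₀`, `k = μ g₀`
(Bär–Hanke (22)). Everything is proved; no definitions, no named facts (D-0026).

## References

* C. Bär, B. Hanke, *Boundary conditions for scalar curvature*, arXiv:2012.09127, §3, (9),
  Prop. 26, (15)–(24), proof of Thm. 27. [BarHanke2023]
-/

noncomputable section

set_option maxSynthPendingDepth 3

open Bundle Set Filter Function Metric TopologicalSpace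
open scoped Manifold ContDiff Topology

namespace Literature.Geometry.Riemannian

open Literature.Geometry.Lorentzian
open Literature.Geometry.Lorentzian.PseudoRiemannianMetric
open Literature.Geometry.Lorentzian.MetricCoord

variable {E' : Type*} [NormedAddCommGroup E'] [InnerProductSpace ℝ E'] [FiniteDimensional ℝ E']
  {N : Type*} [TopologicalSpace N] [ChartedSpace E' N] [IsManifold 𝓘(ℝ, E') ∞ N]
  (G G' : PseudoRiemannianMetric (𝓘(ℝ, E').prod 𝓘(ℝ, ℝ)) ∞ (E' × ℝ)
    (TangentSpace (𝓘(ℝ, E').prod 𝓘(ℝ, ℝ)) : N × ℝ → Type _)) [G.HasLeviCivita] [G'.HasLeviCivita]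
  {ψ : OpenPartialHomeomorph N E'}
  (hG : G.IsRiemannian) (hG' : G'.IsRiemannian)
  (hcyl : ∀ (p : N × ℝ) (v w : TangentSpace (𝓘(ℝ, E').prod 𝓘(ℝ, ℝ)) p),
    G.val p v w = G.val p ((v.1, 0) : TangentSpace (𝓘(ℝ, E').prod 𝓘(ℝ, ℝ)) p)
      ((w.1, 0) : TangentSpace (𝓘(ℝ, E').prod 𝓘(ℝ, ℝ)) p) + v.2 * w.2)
  (hcyl' : ∀ (p : N × ℝ) (v w : TangentSpace (𝓘(ℝ, E').prod 𝓘(ℝ, ℝ)) p),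
    G'.val p v w = G'.val p ((v.1, 0) : TangentSpace (𝓘(ℝ, E').prod 𝓘(ℝ, ℝ)) p)
      ((w.1, 0) : TangentSpace (𝓘(ℝ, E').prod 𝓘(ℝ, ℝ)) p) + v.2 * w.2)
  (hψ : ψ ∈ IsManifold.maximalAtlas 𝓘(ℝ, E') ∞ N)
  (F : E' → ℝ → E' →L[ℝ] E' →L[ℝ] ℝ)
  (hF : ∀ (y : E') (s : ℝ), F y s = MaxAtlasChart.metricRepr
    (G.inducedMetric (fun x : N ↦ ((x, s) : N × ℝ))
      (contMDiff_pullbackBilin_holds (I := 𝓘(ℝ, E').prod 𝓘(ℝ, ℝ)) (M := N × ℝ)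
        (I' := 𝓘(ℝ, E')) (N := N))
      (isSpacelikeImmersion_cylSlice G hG s)) hψ y)
  (F' : E' → ℝ → E' →L[ℝ] E' →L[ℝ] ℝ)
  (hF' : ∀ (y : E') (s : ℝ), F' y s = MaxAtlasChart.metricRepr
    (G'.inducedMetric (fun x : N ↦ ((x, s) : N × ℝ))
      (contMDiff_pullbackBilin_holds (I := 𝓘(ℝ, E').prod 𝓘(ℝ, ℝ)) (M := N × ℝ)
        (I' := 𝓘(ℝ, E')) (N := N))
      (isSpacelikeImmersion_cylSlice G' hG' s)) hψ y)

include hcyl hcyl' hF hF'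

omit [FiniteDimensional ℝ E'] [ChartedSpace E' N] [IsManifold 𝓘(ℝ, E') ∞ N] [G.HasLeviCivita]
  [G'.HasLeviCivita] hcyl hcyl' hF hF' in
/-- A vector inequality used three times: with `‖X0‖, ‖Xd‖ ≤ b`, `‖Hv‖ ≤ k b²` (`0 ≤ k ≤ 4`) and
`Ct²b + |t − χ₀| b + 8|χ₀| b² ≤ d`,
`‖0·Xt + (1 − Ct²) X0 + (t − χ₀) Xd − 2χ₀ Hv − X0‖ ≤ d`. [folklore] -/
theorem norm_regionB_combo_sub_le {W : Type*} [NormedAddCommGroup W] [NormedSpace ℝ W]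
    (Xt X0 Xd Hv : W) {b C t χ₀ d k : ℝ} (hC : 0 ≤ C)
    (hdd : C * t ^ 2 * b + |t - χ₀| * b + 8 * |χ₀| * b ^ 2 ≤ d)
    (hX0 : ‖X0‖ ≤ b) (hXd : ‖Xd‖ ≤ b) (hHv : ‖Hv‖ ≤ k * b ^ 2) (hk4 : k ≤ 4) :
    ‖(0 : ℝ) • Xt + (1 - C * t ^ 2) • X0 + (t - χ₀) • Xd + (-(2 * χ₀)) • Hv - X0‖ ≤ d := by
  have hid : (0 : ℝ) • Xt + (1 - C * t ^ 2) • X0 + (t - χ₀) • Xd + (-(2 * χ₀)) • Hv - X0 =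
      (-(C * t ^ 2)) • X0 + (t - χ₀) • Xd + (-(2 * χ₀)) • Hv := by module
  rw [hid]
  have e1 : ‖(-(C * t ^ 2)) • X0‖ ≤ C * t ^ 2 * b := by
    rw [norm_smul, Real.norm_eq_abs, abs_neg, abs_of_nonneg (by positivity)]; gcongr
  have e2 : ‖(t - χ₀) • Xd‖ ≤ |t - χ₀| * b := by
    rw [norm_smul, Real.norm_eq_abs]; gcongr
  have e3 : ‖(-(2 * χ₀)) • Hv‖ ≤ 2 * |χ₀| * (k * b ^ 2) := by
    rw [norm_smul, Real.norm_eq_abs, abs_neg, abs_mul, abs_of_pos (by norm_num : (0:ℝ) < 2)]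
    gcongr
  have hχ0 : 0 ≤ |χ₀| := abs_nonneg _
  calc _ ≤ C * t ^ 2 * b + |t - χ₀| * b + 2 * |χ₀| * (k * b ^ 2) :=
        norm_add₃_le.trans (add_le_add_three e1 e2 e3)
    _ ≤ C * t ^ 2 * b + |t - χ₀| * b + 8 * |χ₀| * b ^ 2 := by
        nlinarith [mul_nonneg hχ0 (sq_nonneg b)]
    _ ≤ d := hdd

set_option maxSynthPendingDepth 4 in
set_option synthInstance.maxHeartbeats 400000 in
set_option maxHeartbeats 4000000 in
/-- **Region B lower bound** (Bär–Hanke, proof of Prop. 26, (17)–(24), at a point): at a time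
`t ∈ [0, 1]` where `a(t) = 1`, `ȧ(t) = ä(t) = 0`, with chart bounds `b` for `G` at `s = 0` and for
`μ̃ = μ ∘ ψ⁻¹`, the derived constant `b'`, a `C²`-distance `d ≥ Ct²b + |t − χ(t)|b + 8|χ(t)|b²`
with `b'd ≤ ½`, `2nb'³d ≤ ½`, the dichotomy "`χ̈(t) ≤ 0` and `|χ̈(t)| d ≤ L`, or `|χ̈(t)| ≤ c₀`"
of Lemma 25, and the mean-curvature hypothesis `H(z) + nμ(z) ≤ 0`,
`scal_{G'}(ψ⁻¹p, t) ≥ 2C(n − ½) − 2042 n² b'⁵ − 4 n b'³ (L + c₀)`.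
[cite: BarHanke2023, §3, Prop. 26, (17)–(24)] -/
theorem regionB_scalarCurvature_lower_bound
    {μ : N → ℝ} (hμ : ContMDiff 𝓘(ℝ, E') 𝓘(ℝ, ℝ) ∞ μ)
    {a χ : ℝ → ℝ} {C b b' d c₀ L t : ℝ} (ha : ContDiff ℝ ∞ a) (hχ : ContDiff ℝ ∞ χ)
    (hFF' : ∀ (p : MaxAtlasChart.target ψ) (s : ℝ), F' p s = (1 - a s) • F p s +
      (a s * (1 - (C * s ^ 2 + 2 * μ (ψ.symm p) * χ s))) • F p 0 +
      (a s * (s - χ s)) • deriv (fun σ : ℝ ↦ F p σ) 0)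
    {F₁ : E' → ℝ → E' →L[ℝ] E' →L[ℝ] E' →L[ℝ] ℝ}
    (hF₁ : ∀ (y : E') (s : ℝ), F₁ y s =
      (fderiv ℝ (fun q : E' × ℝ ↦ F q.1 q.2) (y, s)).comp (ContinuousLinearMap.inl ℝ E' ℝ))
    {F₂ : E' → ℝ → E' →L[ℝ] E' →L[ℝ] E' →L[ℝ] E' →L[ℝ] ℝ}
    (hF₂ : ∀ (y : E') (s : ℝ), F₂ y s =
      (fderiv ℝ (fun q : E' × ℝ ↦ F₁ q.1 q.2) (y, s)).comp (ContinuousLinearMap.inl ℝ E' ℝ))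
    (hat : a t = 1) (ha' : deriv a t = 0) (ha'' : deriv (deriv a) t = 0)
    (hb : 1 ≤ b) (hb' : 1 ≤ b') (hC : 0 ≤ C) (hc₀ : 0 ≤ c₀) (hL : 0 ≤ L) (hd0 : 0 ≤ d)
    (ht0 : 0 ≤ t)
    (hbd : b' * d ≤ 2⁻¹) (hnd : 2 * Module.finrank ℝ E' * b' ^ 3 * d ≤ 2⁻¹)
    (hdd : C * t ^ 2 * b + |t - χ t| * b + 8 * |χ t| * b ^ 2 ≤ d)
    (hWb : b * b + b ≤ b')
    (hhb : (2 * C * t + 2 * b * |deriv χ t|) * b + (1 + |deriv χ t|) * b ≤ b')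
    (hbb' : b ≤ b')
    (hcase : (deriv (deriv χ) t ≤ 0 ∧ |deriv (deriv χ) t| * d ≤ L) ∨ |deriv (deriv χ) t| ≤ c₀)
    (p : MaxAtlasChart.target ψ)
    (hs : ‖sharpAt (fun y ↦ F y 0) p‖ ≤ b) (h10 : ‖F₁ p 0‖ ≤ b) (h20 : ‖F₂ p 0‖ ≤ b)
    (hF00 : ‖F p 0‖ ≤ b) (hFd0 : ‖deriv (fun s : ℝ ↦ F p s) 0‖ ≤ b)
    (h1d : ‖deriv (F₁ p) 0‖ ≤ b) (h2d : ‖deriv (F₂ p) 0‖ ≤ b)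
    (hμ0 : |μ (ψ.symm p)| ≤ b) (hμ1 : ‖fderiv ℝ (fun y : E' ↦ μ (ψ.symm y)) p‖ ≤ b)
    (hμ2 : ‖fderiv ℝ (fderiv ℝ (fun y : E' ↦ μ (ψ.symm y))) p‖ ≤ b)
    (hμH : G.meanCurvature (fun y : N ↦ ((y, (0 : ℝ)) : N × ℝ))
        (contMDiff_pullbackBilin_holds (I := 𝓘(ℝ, E').prod 𝓘(ℝ, ℝ)) (M := N × ℝ)
          (I' := 𝓘(ℝ, E')) (N := N))
        (isSpacelikeImmersion_cylSlice G hG 0)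
        (fun y ↦ velocity (𝓘(ℝ, E').prod 𝓘(ℝ, ℝ)) (fun s : ℝ ↦ ((y, s) : N × ℝ)) 0) (ψ.symm p) +
      (Module.finrank ℝ E' : ℝ) * μ (ψ.symm p) ≤ 0) :
    2 * C * (Module.finrank ℝ E' - 2⁻¹) - 2042 * (Module.finrank ℝ E') ^ 2 * b' ^ 5
        - 4 * Module.finrank ℝ E' * b' ^ 3 * (L + c₀) ≤
      G'.scalarCurvature (ψ.symm p, t) := by
  have hb0 : 0 ≤ b := zero_le_one.trans hb
  have hU : IsOpen ψ.target := ψ.open_target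
  have hx : (p : E') ∈ ψ.target := p.2
  -- the two metric families
  have hAm : IsMetricOn (fun y ↦ F y 0) ψ.target :=
    (isMetricFamilyOn_cylComponents G hG hψ F hF).isMetricOn 0 (mem_univ _)
  have hQm : IsMetricOn (fun y ↦ F' y t) ψ.target :=
    (isMetricFamilyOn_cylComponents G' hG' hψ F' hF').isMetricOn t (mem_univ _)
  have hFs : ContDiffOn ℝ ∞ (fun q : E' × ℝ ↦ F q.1 q.2) (ψ.target ×ˢ univ) :=
    contDiffOn_cylComponents G hG hψ F hF
  have hF₁s : ContDiffOn ℝ ∞ (fun q : E' × ℝ ↦ F₁ q.1 q.2) (ψ.target ×ˢ univ) :=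
    contDiffOn_family₁ hU hFs hF₁
  -- `μ̃ = μ ∘ ψ⁻¹` and `H = μ̃ F(·,0)` are smooth on the target
  have hμt : ContDiffOn ℝ ∞ (fun y : E' ↦ μ (ψ.symm y)) ψ.target := by
    have h := hμ.comp_contMDiffOn (contMDiffOn_symm_of_mem_maximalAtlas hψ)
    exact (contMDiffOn_iff_contDiffOn.1 h)
  have hF0s : ContDiffOn ℝ ∞ (fun y : E' ↦ F y 0) ψ.target := by
    have h := hFs.comp (contDiffOn_id.prodMk contDiffOn_const) (fun y hy ↦ ⟨hy, mem_univ (0 : ℝ)⟩)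
    exact h
  have hH : ContDiffOn ℝ ∞ (fun y : E' ↦ μ (ψ.symm y) • F y 0) ψ.target := hμt.smul hF0s
  -- ### time derivatives of the deformed slice at `p`
  have hfC : ContDiff ℝ ∞ (fun s : ℝ ↦ F p s) := contDiff_cylComponents_right G hG hψ F hF p
  have hg : (fun s : ℝ ↦ F' p s) = fun s ↦ (1 - a s) • F p s +
      (a s * (1 - (C * s ^ 2 + 2 * μ (ψ.symm p) * χ s))) • F p 0 +
      (a s * (s - χ s)) • deriv (fun σ : ℝ ↦ F p σ) 0 := funext (hFF' p)
  have hQ1 : deriv (fun s : ℝ ↦ F' p s) t =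
      (-(2 * C * t + 2 * μ (ψ.symm p) * deriv χ t)) • F p 0 +
        (1 - deriv χ t) • deriv (fun σ : ℝ ↦ F p σ) 0 := by
    rw [hg]
    exact deriv_normalFormSlice_of_regionB hfC ha hχ hat ha'
  have hQ2 : deriv (deriv (fun s : ℝ ↦ F' p s)) t =
      (-(2 * C)) • F p 0 + (2 * deriv (deriv χ) t) •
        (-μ (ψ.symm p) • F p 0 - (2⁻¹ : ℝ) • deriv (fun σ : ℝ ↦ F p σ) 0) := by
    rw [hg]
    exact deriv_deriv_normalFormSlice_of_regionB hfC ha hχ hat ha' ha''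
  -- ### space derivatives at `p`
  have hEq : EqOn (fun y ↦ F' y t) (fun y ↦ (0 : ℝ) • F y t + (1 - C * t ^ 2) • F y 0 +
      (t - χ t) • deriv (F y) 0 + (-(2 * χ t)) • (fun y : E' ↦ μ (ψ.symm y) • F y 0) y)
      ψ.target := by
    intro y hy
    have h := hFF' ⟨y, hy⟩ t
    simp only [hat] at h
    simp only
    rw [h]
    module
  have hD1 := fderiv_combo hU hFs hF₁ hH hEq hx
  have hEq1 := eqOn_fderiv_combo hU hFs hF₁ hH hEq
  have hH1 : ContDiffOn ℝ ∞ (fderiv ℝ (fun y : E' ↦ μ (ψ.symm y) • F y 0)) ψ.target :=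
    hH.fderiv_of_isOpen hU le_rfl
  have hD2 := fderiv_combo (F := F₁) (F₁ := F₂) hU hF₁s hF₂ hH1 hEq1 hx
  have hA1 : fderiv ℝ (fun y ↦ F y 0) p = F₁ p 0 := fderiv_slice₁ hU hFs hF₁ hx 0
  have hA2 : fderiv ℝ (fderiv ℝ (fun y ↦ F y 0)) p = F₂ p 0 := by
    have hev : fderiv ℝ (fun y ↦ F y 0) =ᶠ[𝓝 (p : E')] fun y ↦ F₁ y 0 := by
      filter_upwards [hU.mem_nhds hx] with y hy
      exact fderiv_slice₁ hU hFs hF₁ hy 0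
    rw [hev.fderiv_eq]
    exact fderiv_slice₁ hU hF₁s hF₂ hx 0
  -- `μ̃` and its derivatives, Leibniz bounds for `H = μ̃ F(·,0)`
  have hμd1 : ‖fderiv ℝ (fun y ↦ F y 0) p‖ ≤ b := by rw [hA1]; exact h10
  have hμd2 : ‖fderiv ℝ (fderiv ℝ (fun y ↦ F y 0)) p‖ ≤ b := by rw [hA2]; exact h20
  have hDH : ‖fderiv ℝ (fun y : E' ↦ μ (ψ.symm y) • F y 0) p‖ ≤ 2 * b ^ 2 := by
    have h := norm_fderiv_smul_le hU hμt hF0s hx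
    calc _ ≤ |μ (ψ.symm p)| * ‖fderiv ℝ (fun y ↦ F y 0) p‖ +
          ‖fderiv ℝ (fun y : E' ↦ μ (ψ.symm y)) p‖ * ‖F p 0‖ := h
      _ ≤ b * b + b * b := by gcongr
      _ = 2 * b ^ 2 := by ring
  have hDDH : ‖fderiv ℝ (fderiv ℝ (fun y : E' ↦ μ (ψ.symm y) • F y 0)) p‖ ≤ 4 * b ^ 2 := by
    have h := norm_fderiv_fderiv_smul_le hU hμt hF0s hx
    calc _ ≤ |μ (ψ.symm p)| * ‖fderiv ℝ (fderiv ℝ (fun y ↦ F y 0)) p‖ +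
          2 * (‖fderiv ℝ (fun y : E' ↦ μ (ψ.symm y)) p‖ * ‖fderiv ℝ (fun y ↦ F y 0) p‖) +
          ‖fderiv ℝ (fderiv ℝ (fun y : E' ↦ μ (ψ.symm y))) p‖ * ‖F p 0‖ := h
      _ ≤ b * b + 2 * (b * b) + b * b := by gcongr
      _ = 4 * b ^ 2 := by ring
  -- ### the `d`-hypotheses of step B
  have hd₀ : ‖F' p t - F p 0‖ ≤ d := by
    have h := hEq hx
    simp only at h
    rw [h]
    refine norm_regionB_combo_sub_le _ _ _ _ (k := 1) hC hdd hF00 hFd0 ?_ (by norm_num)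
    rw [norm_smul, Real.norm_eq_abs]
    calc |μ (ψ.symm p)| * ‖F p 0‖ ≤ b * b := by gcongr
      _ = 1 * b ^ 2 := by ring
  have hd₁ : ‖fderiv ℝ (fun y ↦ F' y t) p - fderiv ℝ (fun y ↦ F y 0) p‖ ≤ d := by
    rw [hD1, hA1]
    exact norm_regionB_combo_sub_le _ _ _ _ (k := 2) hC hdd h10 h1d hDH (by norm_num)
  have hd₂ : ‖fderiv ℝ (fderiv ℝ (fun y ↦ F' y t)) p - fderiv ℝ (fderiv ℝ (fun y ↦ F y 0)) p‖ ≤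
      d := by
    rw [hD2, hA2]
    exact norm_regionB_combo_sub_le _ _ _ _ (k := 4) hC hdd h20 h2d hDDH le_rfl
  -- ### the remaining inputs of step B
  have hs' : ‖sharpAt (fun y ↦ F y 0) p‖ ≤ b' := hs.trans hbb'
  have h1' : ‖fderiv ℝ (fun y ↦ F y 0) p‖ ≤ b' := hμd1.trans hbb'
  have h2' : ‖fderiv ℝ (fderiv ℝ (fun y ↦ F y 0)) p‖ ≤ b' := hμd2.trans hbb'
  have hhh : ‖deriv (fun s : ℝ ↦ F' p s) t‖ ≤ b' := by
    rw [hQ1]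
    have e1 : ‖(-(2 * C * t + 2 * μ (ψ.symm p) * deriv χ t)) • F p 0‖ ≤
        (2 * C * t + 2 * b * |deriv χ t|) * b := by
      rw [norm_smul, Real.norm_eq_abs, abs_neg]
      have : |2 * C * t + 2 * μ (ψ.symm p) * deriv χ t| ≤ 2 * C * t + 2 * b * |deriv χ t| := by
        calc _ ≤ |2 * C * t| + |2 * μ (ψ.symm p) * deriv χ t| := abs_add_le _ _
          _ = 2 * C * t + 2 * (|μ (ψ.symm p)| * |deriv χ t|) := by
              rw [abs_of_nonneg (by positivity), abs_mul, abs_mul,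
                abs_of_pos (by norm_num : (0:ℝ) < 2)]
              ring
          _ ≤ 2 * C * t + 2 * (b * |deriv χ t|) := by gcongr
          _ = _ := by ring
      calc _ ≤ (2 * C * t + 2 * b * |deriv χ t|) * ‖F p 0‖ := by gcongr
        _ ≤ (2 * C * t + 2 * b * |deriv χ t|) * b := by gcongr
    have e2 : ‖(1 - deriv χ t) • deriv (fun σ : ℝ ↦ F p σ) 0‖ ≤ (1 + |deriv χ t|) * b := by
      rw [norm_smul, Real.norm_eq_abs]
      have : |1 - deriv χ t| ≤ 1 + |deriv χ t| := by
        calc _ ≤ |(1:ℝ)| + |deriv χ t| := abs_sub _ _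
          _ = 1 + |deriv χ t| := by rw [abs_one]
      calc _ ≤ (1 + |deriv χ t|) * ‖deriv (fun σ : ℝ ↦ F p σ) 0‖ := by gcongr
        _ ≤ (1 + |deriv χ t|) * b := by gcongr
    exact (norm_add_le_of_le e1 e2).trans hhb
  have hW : ‖-μ (ψ.symm p) • F p 0 - (2⁻¹ : ℝ) • deriv (fun σ : ℝ ↦ F p σ) 0‖ ≤ b' := by
    have e1 : ‖-μ (ψ.symm p) • F p 0‖ ≤ b * b := by
      rw [neg_smul, norm_neg, norm_smul, Real.norm_eq_abs]; gcongr
    have e2 : ‖(2⁻¹ : ℝ) • deriv (fun σ : ℝ ↦ F p σ) 0‖ ≤ b := by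
      rw [norm_smul, Real.norm_eq_abs, abs_of_pos (by norm_num : (0:ℝ) < 2⁻¹)]
      calc 2⁻¹ * ‖deriv (fun σ : ℝ ↦ F p σ) 0‖ ≤ 2⁻¹ * b := by gcongr
        _ ≤ b := by linarith
    exact (norm_sub_le_of_le e1 e2).trans hWb
  -- `tr_{g₀}(W) = −nμ − H ≥ 0`
  have htrW : 0 ≤ mtrAt (fun y ↦ F y 0) p
      (-μ (ψ.symm p) • F p 0 - (2⁻¹ : ℝ) • deriv (fun σ : ℝ ↦ F p σ) 0) := by
    have hHm := meanCurvature_slice_eq_mtrAt G hG hcyl hψ F hF p 0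
    have hself : mtrAt (fun y ↦ F y 0) p (F p 0) = Module.finrank ℝ E' :=
      mtrAt_self (hAm.isInvertible p hx)
    rw [mtrAt_sub, mtrAt_smul, ← hHm]
    have h' : mtrAt (fun y ↦ F y 0) (p : E') ((fun y ↦ F y 0) (p : E')) = Module.finrank ℝ E' :=
      hself
    simp only at h'
    rw [h']
    nlinarith [hμH]
  have hcase' : (deriv (deriv χ) t ≤ 0 ∧ |deriv (deriv χ) t| * ‖F' p t - F p 0‖ ≤ L) ∨
      |deriv (deriv χ) t| ≤ c₀ := by
    rcases hcase with ⟨hneg, hLd⟩ | hc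
    · refine Or.inl ⟨hneg, ?_⟩
      calc |deriv (deriv χ) t| * ‖F' p t - F p 0‖ ≤ |deriv (deriv χ) t| * d := by gcongr
        _ ≤ L := hLd
    · exact Or.inr hc
  -- ### step B
  have key := stepB_pointwise hAm hQm hx hb' hd0 hC hc₀ hL hbd hnd hs' h1' h2' hd₀ hd₁ hd₂
    (hh := deriv (fun s : ℝ ↦ F' p s) t)
    (W := -μ (ψ.symm p) • F p 0 - (2⁻¹ : ℝ) • deriv (fun σ : ℝ ↦ F p σ) 0)
    (τ₂ := deriv (deriv χ) t) hhh hW htrW hcase'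
  -- ### the printed formula (9) for `G'`
  have hSG' := cyl_scalarCurvature_eq_coord_printed G' hG' hcyl' hψ F' hF' p t
  have hQ2' : deriv (fun s ↦ deriv (fun σ : ℝ ↦ F' p σ) s) t =
      (-(2 * C)) • F p 0 + (2 * deriv (deriv χ) t) •
        (-μ (ψ.symm p) • F p 0 - (2⁻¹ : ℝ) • deriv (fun σ : ℝ ↦ F p σ) 0) := hQ2
  rw [hSG', hQ2']
  linarith [key]

end Literature.Geometry.Riemannian

end
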